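import Mathlib
import HarnessLib
import HarnessLib.Audit
import Summits.Parity.Statement
import HarnessLib.Audit.Status.Attr

/-!
Route: PrimeDeterminantCells

DORMANT since 2026-08-25T11:00:30Z (reconciler: no traction for 7.6 d (last activity item-evidence-added at 2026-08-17T19:12:59Z); parked, not closed — `ledger route dormant route-Parity-PrimeDeterminantCells --off` to reactivate) — unstaffed, not closed; items shared with open routes are served there. `ledger route dormant <id> --off` reactivates.

# Route PrimeDeterminantCells — GHL from the alternating prime-determinant seesaw (Bombieri's sieve
on every coordinate) plus uniform central determinant cells, via the d=1 fibration

It suffices to show X = AlternatingSeesawLawR ∧ CentralCellsDimOne (conforming re-route of card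
prime-determinant-seesaw; rev 10, 2026-08-17: deciding theorem RE-CUT to the two cruxes — the shared
d = 1 waypoint DimOne (stmt-Parity-0819), whose registered skeleton was found to hide the summit, is
no longer an item of this route; rev 16: the d = 1 → all-d fibration seam is the provable-now
support FibrationLift, a hypothesis of `closes`, so the route FILE imports nothing beyond the
Statement). For a one-dimensional system Ψ = (ψ₁,…,ψ_t) (Green–Tao d = 1, size ≤ L, convex K ⊆
[−N,N]) put S = Σ_{n∈K} ΠΛ(ψ_i(n)) (tree: vonMangoldtSum), M = β_∞Πβ_p (archFactor·singularProduct)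
and the CENTRAL DETERMINANT CELL C_t = Σ_{n∈K} Π_i W(ψ_i(n)), W(m) = Σ_{ab=m, m^{1/3}≤a≤m^{2/3}}
Λ(a)Λ(b): every form is required to be a product of two balanced primes ("prime determinant
configurations"). AlternatingSeesawLawR (crux 3, inductive form): if every shorter tuple already has
its Dickson–Hardy–Littlewood asymptotic (the d = 1 statement for all t' < t), then C_t = (1/3)^t
(log N)^t·(M + (−1)^t(S − M)) + o(N log^t N) uniformly — Bombieri's sieve applied on each coordinate
in turn flips s ↦ 2 − s; for t coordinates the flips produce the inclusion–exclusion main term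
Σ_{A⊆[t]} (−1)^{|A|} 2^{t−|A|} (M/M_A)·S_A over sub-tuples A, which collapses to the two-term form
exactly under the inductive hypothesis; t-sided cells are ∝ s for even t and ∝ 2 − s for odd t (t =
2, shift 2: twins = prime 2×2 matrices of determinant 2). CentralCellsDimOne (crux 2): C_t = (1/3)^t
(log N)^t·M + o(N log^t N) uniformly (the cells have their Hardy–Littlewood value). Subtracting the
two estimates inside a strong induction on t gives |S − M| ≤ εN, i.e. Green–Tao's Conjecture 1.2 at
d = 1 uniformly in the shifts, and the fibration lift FibrationLift (support; GreenTao2010 remark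
after Conj. 1.2, PROVED in the tree as Theorems.FibrationGlue.generalizedHardyLittlewood_of_dimOne)
lifts d = 1 to every d — the conjunct. The twin instances CentralPrimeDeterminant (Σ_{n≤x}
W(n)W(n+2) ∼ (1/9)𝔖({0,2}) x log²x) and CentralHyperbola (Σ W(n)Λ(n+2) ∼ (1/3)𝔖({0,2}) x log x) —
the h = 2 cells where the dispersion bet is tested (and refuted) first — were items until rev 11 and
are PARKED since rev 12 (moot items stmt-Parity-9539/9540; exact Lean signatures, why/sources and
the re-attach recipe in the route evidence file parked_twin_statements.md, informal statements in
the rationale's TWO-LAYER PLAN): never hypotheses of `closes` and not in its cone (glue.unused-crux;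
BC6), they return by `workitem add` with the same signatures together with the instance glue
TwinInstance : CentralCellsDimOne → CentralPrimeDeterminant, which puts the twin cell on crux 2's
kill path.
Lean: `AlternatingSeesawLawR ∧ CentralCellsDimOne`

## Assembly
`closes (hC : CentralCellsDimOne) (hL : AlternatingSeesawLawR) (hF : FibrationLift) :
GeneralizedHardyLittlewood` (glue.lean, rev 16; certified: lean check rc 0, no sorry, axioms
propext/Classical.choice/Quot.sound; #h21_check_closes ok, codes [], in_cone = all 4 items): it
proves the item `Assembly := CentralCellsDimOne → AlternatingSeesawLawR →
GeneralizedHardyLittlewood` inline — strong induction on t (the law's antecedent at t is literally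
the induction hypothesis; the two cell estimates at ε' = ε/(2·3^t) differ by (1/3)^t(log N)^t|S −
M|; divide by (log N)^t > 0 for N ≥ 2) gives Green–Tao's Conj. 1.2 at d = 1, then the support binder
hF : FibrationLift (the d = 1 statement, inlined verbatim as the hypothesis of
Theorems.FibrationGlue.generalizedHardyLittlewood_of_dimOne, → GeneralizedHardyLittlewood) — and
applies it to the two cruxes. Binders = the two ranked cruxes + one provable-now support, exactly
the shape of route LeeYangFibres (`closes … (hF : FibrationLemma)`); no target binder. Imports (rev
16): NONE beyond the gate header (Mathlib, HarnessLib, Summits.Parity.Statement) — the rev-13 import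
Theorems.LeeYangFibresFibrationLemmaFinal, whose file chain reached Literature …WTrick →
…MainReduction → …NormalFormExtension → …NormalForm → …Transference (where the unproved named facts
GreenTao2010_gowersUniformity, …gowersUniformityAt, …wTrickedAt, …wTrickedProductAt,
…mainNormalFormAt are defined, used by nothing here), is DROPPED: the file-level cone is now the
Statement's own, the constant cone stays 0 unproved (h21_route_deps n = 22). FibrationLift is closed
by a prover in one line from that Theorems module (`fun h =>
FibrationGlue.generalizedHardyLittlewood_of_dimOne h`), the import living in the proof file, not in
the route file.

Rationale: WHY THIS LINE. Bombieri's asymptotic sieve (BombieriRIMS1977 p.7; FriedlanderIwaniecPisa1978 Thm 1;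
PROVED in tree: Literature.NumberTheory.Sieve.Bombieri1976_asymptotic_sieve_holds,
Bombieri1976_selbergFormula_holds) determines everything about a level-1 sifted sequence except one
parameter s = S/M (bombieri_asymptotic_sieve_indeterminacy); sifting the coordinate ψ_k against the
weights carried by the other forms and localising with the vector (k₁,k₂) form + Bernstein
polynomials (Debouzy2019, arXiv:1907.06393, who proves the one-sided case under EH) turns Λ(ψ_k)
into the balanced two-prime weight W(ψ_k) at the cost of s ↦ 2 − s; iterating over all coordinates
yields an inclusion–exclusion law over sub-tuples, C_t ≈ (1/3)^t log^t N · Σ_{A⊆[t]} (−1)^{|A|}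
2^{t−|A|} (M/M_A) S_A, which is the two-term alternating law M + (−1)^t (S − M) as soon as every
proper sub-tuple has its Hardy–Littlewood value — hence the inductive crux AlternatingSeesawLawR
(rev 6, answering refuter review rreview-0815T14 P1) and the strong induction on t, which since rev
10 is proved INSIDE the deciding theorem `closes` (no induction item; since rev 16 the only support
is the fibration lift). So under EH-type level hypotheses GHL at d = 1 is EQUIVALENT to the
Hardy–Littlewood asymptotic for all-prime determinant configurations with every variable in the
central window — the shape where dispersion / Kloosterman technology lives
(BombieriFriedlanderIwaniecActa1986, DukeFriedlanderIwaniec1997), instead of Möbius sums (retired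
MobiusShiftedPrimes = the lopsided k = 1 residual) or bare twins. Filing the law UNCONDITIONALLY as
a crux (its only known proof route is conditional: EH + tuple/moment GEH-fragments) and the cells as
the second crux makes the route decide the Statement through the fibration lift FibrationLift
(support, rev 16; = the tree's PROVED Theses-free fibration lemma
Theorems.FibrationGlue.generalizedHardyLittlewood_of_dimOne [GreenTao2010, p.6], taken as a
hypothesis of `closes` so that the route file imports no Theorems module); rev 10 (route-repair
2026-08-17, gate finding skeleton.hides-summit on the shared d = 1 waypoint stmt-Parity-0819 DimOne
≡ S by EngineToGHL.generalizedHardyLittlewood_iff_dimOne): DimOne, FibrationLemma (0822, proved) and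
SeesawInduction (11411) are no longer items of this route — its OWN decomposition of the d = 1
statement is the pair of cruxes with a proved seam, never DimOne's registered sieve-model skeleton.
Areas imported: sieve axiomatics (Bombieri/Friedlander–Iwaniec), approximation theory (Bernstein
squeeze), bilinear Kloosterman forms as the intended engine. Nearest theorems on the cell object:
Evans2022 (E₂-twin correlations with constant 𝔖(h) on average over shifts, lopsided factor),
GoldstonEtAl2008 (E₂ gaps ≤ 6); Debouzy2019 Thm 2 (one-sided localised seesaw at h = 2 under EH).
Negatives index: ConvMomentLevelOne (stmt-Parity-9541, this line's own settled negative edge: the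
FULL convolution Λ⋆Λ has a secondary main term on odd multiples of small primes) — nothing in the
route uses full-window convolutions any more.

RANKED CRUXES. #2 CentralCellsDimOne (crux) — uniform central determinant cells: for all t ≥ 1, L, ε
> 0 there is N₀ such that for N ≥ N₀, every non-degenerate d = 1 system Ψ of t forms with ‖Ψ‖_N ≤ L
and every convex K ⊆ [−N,N]: |Σ_{n∈K∩ℤ} Π_i W(ψ_i(n)) − (1/3)^t (log N)^t β_∞Πβ_p| ≤ ε N (log N)^t,
W(m) = Σ_{ab=m, m^{1/3}≤a≤m^{2/3}} Λ(a)Λ(b) (m ≤ 0 ↦ 0 via toNat). The parity-sensitive input of the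
card, generalised from twins (t = 2, Ψ = (n, n+2): the parked twin statement
CentralPrimeDeterminant) to every one-dimensional system; registered BC3 skeleton
Cruxes/CentralCellsDimOne/Lines/birth.lean (4 stubs). [difficulty: open-problem] (why it might fail:
⟺ the d = 1 statement given the law (parity-complete, Siegel-sensitive in the uniform aspect); per
system every dispersion pairing leaves prime PAIRS on lines over a 2-parameter family (Type II for
E₂−h, Harman p.286 shape); no family-averaged HL for line families is known.) [Harman2007,
BombieriFriedlanderIwaniecActa1986, DukeFriedlanderIwaniec1997, MatomakiRadziwillTao2019, Evans2022,
GreenTao2010]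
#3 AlternatingSeesawLawR (crux; rev 6 inductive restatement of AlternatingSeesawLaw 9538) — for all
t ≥ 1 and L: IF the d = 1 statement holds for every t' < t (all L'; inlined verbatim, no DimOne
decl), THEN for all ε > 0 there is N₀ such that for N ≥ N₀, uniformly over non-degenerate d = 1
systems Ψ of t forms with ‖Ψ‖_N ≤ L and convex K ⊆ [−N,N]: |Σ_{n∈K∩ℤ} Π_i W(ψ_i(n)) − (1/3)^t (log
N)^t (M + (−1)^t (S − M))| ≤ ε N (log N)^t with S = vonMangoldtSum Ψ K N, M = archFactor Ψ K ·
singularProduct Ψ. Checks: t = 1 (hypothesis vacuous): Σ_{n∈K} W(an+b) = (1/3) log N (2M − S) + o, a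
PNT-level theorem (primes and balanced semiprimes in AP segments; S ∼ M) ✓; t = 2 (hypothesis = PNT
level): Σ W(ψ₁n)W(ψ₂n) = (1/9)(log N)² S + o, the two flips s ↦ 2 − s ↦ s ✓ (known under EH +
GEH₂-type hypotheses at Ψ = (n, n+2)); t = 3: inclusion–exclusion 8 − 4Σs_i + 2Σs_{ij} − s_{123} = 2
− s_{123} under HL for pairs ✓. Known ONLY conditionally (level-1 distribution of the mixed Λ/W
tuple sequences); filed unconditionally; registered BC3 skeleton
Cruxes/AlternatingSeesawLawR/Lines/birth.lean (stubs baseWindowLaw / seesawStep / chainCollapse,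
load-bearing stub_seesawStep). [difficulty: open-problem] (why it might fail: only derivation = t
Bombieri/FI flips, each needing level x^{1−ε} (EH + tuple-GEH) for mixed Λ/W tuple sequences, open
beyond the large sieve; uniformity in shifts ≤ LN is Siegel-sensitive; a window/sign normalisation
slip kills it as stated.) [BombieriRIMS1977, FriedlanderIwaniecPisa1978, Debouzy2019,
arXiv:1907.06393, Ford2004, Polymath8b2014]
#1 Assembly (assembly; rev 10) — CentralCellsDimOne → AlternatingSeesawLawR →
GeneralizedHardyLittlewood: PROVED inside `closes` from the support binder FibrationLift (closes
builds it inline and applies it to the two cruxes — so it is in the deciding theorem's cone),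
closable by a prover in one line from `closes` + the tree's fibration lemma; the former four-binder
cut through SeesawInduction/FibrationLemma/DimOne is retired. [difficulty: provable-now]
[BombieriRIMS1977, GreenTao2010]
#9 FibrationLift (support; rev 16) — (Green–Tao Conj. 1.2 at d = 1, uniform in L: for all t ≥ 1, L,
ε > 0 ∃ N₀ ∀ N ≥ N₀ ∀ non-degenerate Ψ : Fin t → AffLinForm 1 with ‖Ψ‖_N ≤ L ∀ convex K ⊆ [−N,N],
|vonMangoldtSum Ψ K N − archFactor Ψ K · singularProduct Ψ| ≤ εN — inlined verbatim, no DimOne decl)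
→ GeneralizedHardyLittlewood. Green–Tao's fibration remark (2010, after Conj. 1.2), PROVED in the
tree: Theorems.FibrationGlue.generalizedHardyLittlewood_of_dimOne
(LeeYangFibresFibrationLemmaFinal.lean, standard axioms) has exactly this antecedent, so `theorem
fibrationLift_proof : FibrationLift := fun h => FibrationGlue.generalizedHardyLittlewood_of_dimOne
h` closes it from a Theorems file; it is a hypothesis of `closes` (as FibrationLemma
stmt-Parity-0822 is in route LeeYangFibres) precisely so that the ROUTE FILE carries no Theorems
import and its file-level cone is the Statement's own. Not the shared FibrationLemma (0822: `DimOne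
→ GeneralizedHardyLittlewood`, which needs the DimOne decl = the stamped item 0819). [difficulty:
provable-now] [GreenTao2010]

TWO-LAYER PLAN. Foreseen glued splits (nothing filed now): the instance glue TwinInstance :
CentralCellsDimOne → CentralPrimeDeterminant (support, provable: t = 2, Ψ = twinPrimeSystem, K =
realBox; needs singularProduct(twinPrimeSystem) = singularSeries {0,2} from the tree's local factors
localFactor_twinPrimeSystem_odd and ⌊x⌋-to-x bookkeeping), filed TOGETHER with the re-attached twin
statement, which puts CentralPrimeDeterminant on the kill path of crux 2; AlternatingSeesawLawR ⇐
TupleLevelHypotheses (EH + GEH-fragments for mixed window/Λ tuple sequences, uniform;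
conjecture-strength, to be carried as an explicit antecedent, never as a Literature fact) →
LocalisationStep (Bombieri/FI vector theorem per coordinate, s ↦ 2 − s, Bernstein squeeze,
inclusion–exclusion bookkeeping) → AlternatingSeesawLawR; CentralCellsDimOne ⇐ TypeOnePart
(determinant equations with Λ-coefficients on two variables and smooth balanced cofactors: DFI/BFI
dispersion, expected provable while moduli products ≤ x^{1+1/40}) → TypeTwoPart (bilinear Σξ_rη_s
g(rs−h), g the E₂-window weight: the open corner) → CentralCellsDimOne. PARKED TWIN STATEMENTS (rev
12, 2026-08-17; dropped because they were never hypotheses of `closes` nor in its cone —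
glue.unused-crux / BC6 declared-not-in-cone — and an `aside` re-kind is not renderable by the gate
today; moot items, re-attach by `workitem add` with the SAME signatures — exact Lean signatures,
why/sources and recipe in the route evidence file parked_twin_statements.md):
CentralPrimeDeterminant (stmt-Parity-9539; was crux 4, support revs 10–11) — the twin instance (card
item r2, localised): Σ_{n≤x} W(n)W(n+2) ∼ (1/9)·𝔖({0,2})·x log²x, prime 2×2 matrices of determinant
2 with all entries in the central window have their Hardy–Littlewood count; = CentralCellsDimOne at
Ψ = (n, n+2), K = [1,N] up to archFactor = N (tree: archFactor_twinPrimeSystem) and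
singularProduct(twin system) = 𝔖({0,2}); milestone and FALSIFIER NODE of crux 2 (⟺ HL(2) under
EH+GEH₂; Heath-Brown corners are Type II sums for E₂−2; DFI's 1/48 saving reaches only moduli
products ≤ x^{1+1/40}) [Harman2007, DukeFriedlanderIwaniec1997, BombieriFriedlanderIwaniecActa1986,
Evans2022, arXiv:2407.14368]. CentralHyperbola (stmt-Parity-9540; was crux 5, support revs 10–11) —
the one-sided twin cell (card item r3, localised as in Debouzy2019): Σ_{n≤x} W(n)Λ(n+2) ∼
(1/3)·𝔖({0,2})·x log x (central-window hyperbola p₁p₂ + 2 = q); under EH alone EQUIVALENT to HL(2)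
(one-sided cells ∝ 2 − s: Debouzy2019 Thm 2) — the t = 2, A = {one coordinate} instance of the mixed
alternating law behind stub_seesawStep, i.e. the cheapest literature check of crux 3's normalisation
(the bare prime q in {p₁p₂+2} is undetected by any Type-I/II input we have, Harman2007 p.286)
[Debouzy2019, arXiv:1907.06393, Harman2007, BombieriRIMS1977, doi:10.4064/aa-28-2-177-193]. PARKED
EVIDENCE (items of revs 2–5 dropped by the rev-6 cone repair; statements, glosses and re-attach
recipe kept verbatim in the route evidence file parked_evidence_items.md and as moot ledger items:
WindowedConvLevelOne 10832, WindowedSelbergRung 10871, TwoSidedLocalisationR 10877, HyperbolaRung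
9544): the h = 2 conditional theorems (windowed Selberg rung from the tree's Bombieri theorem;
two-sided localisation under EH + windowed GEH-fragment; Debouzy's EH-only hyperbola rung) —
re-attach by `workitem add` with the same signatures once Literature's BombieriAsymptoticSieve no
longer imports ParityBarrierProofs → ParityBarrier → ParityWave0 (or the staffability cone stops
counting antecedent-only conjecture constants); until then they can be pursued Literature-side as
cited conditional theorems (Debouzy2019 Thm 1.1/Thm 2, FriedlanderIwaniecPisa1978 Thm 1 vector
form). Also later: the EH-free finite-level rung of card determinant-seesaw-eh-free (Bombieri's
two-sided bounds 1 ± c_k at BV level, Ford2004 §1) as a child of the law; a LOWER-bound variant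
(liminf cell/expected > 0 ⇒ infinitely many twin primes under the level hypotheses).

KILL CRITERIA. AlternatingSeesawLawR refuted at a single fixed system (e.g. at t = 2 the coefficient
is not (1/9)S given PNT below, or the t = 1 base Σ_{n∈K}W(an+b) ≁ (1/3)(log N)(2M − S)) ⇒ restate if
it is a normalisation slip, close `refuted:AlternatingSeesawLawR` if the law fails under EH+GEH
(that would contradict Bombieri's theorem as vendored — one of them dies). CentralCellsDimOne
refuted ⇒ close `refuted:CentralCellsDimOne` (given the law this is ¬GHL at d = 1 under EH+GEH-type
hypotheses — a major negative result for the whole sub); the parked twin statement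
CentralPrimeDeterminant refuted (numerically, or under EH+GEH₂) ⇒ crux 2 is false at t = 2 (file
¬CentralCellsDimOne via the instance glue) — same close. A refuter showing every Heath-Brown corner
of the central cell needs general-bilinear Type II at level > 3/4 for all identity parameters kills
the dispersion bet ⇒ dormant. The d = 1 statement (DicksonFibration.DimOne, no longer an item here)
or GHL proved elsewhere moots the route; its refutation (e.g. under unbounded Siegel zeros,
MatomakiMerikoski2023) refutes the conjunct itself, not this line specifically.

NOT DECOMPOSED YET. The uniform level hypotheses and the per-coordinate localisation +
inclusion–exclusion step behind the law (layer 2); the (A₁)–(A₅) verifications for the mixed Λ/W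
sequences (helper lemmas via --supports under AlternatingSeesawLawR); the Heath-Brown/Type-I–II
decomposition of the cells; d ≥ 2 (entirely inside the proved fibration lemma, no item); the parked
h = 2 evidence theorems (TWO-LAYER PLAN); numerics.

CHEAPEST FALSIFIER. (1) One afternoon for a grounder: read Debouzy2019 §2.2–2.5 (arXiv:1907.06393
pp.18–25) and FriedlanderIwaniecPisa1978 Thm 1 (vector (k)) to confirm the one-sided localisation
with coefficient (γ−β) and constant 4C₂ = 2𝔖({0,2}) (the preprint prints 2C₂; Bombieri's k = 2 in
the tree says 4C₂ — one of them is wrong and it is decidable by hand), and re-derive the s ↦ 2 − s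
flip for the second coordinate and the inclusion–exclusion pattern at t = 3 (planner NOTES: t = 1,
2, 3 checked against the inductive form). (2) The t = 1 base of the law is PNT-level: prove or
refute Σ_{n∈K} W(an+b) = (1/3)(log N)(2M − S) + o(N log N) uniformly for a ≤ L, |b| ≤ LN — a
refutation here kills the normalisation at once. (3) Numerics (x = 10⁷…10⁹, h = 2, 6): Bombieri
ratios → 1, central cell/((1/9)𝔖x log²x) and hyperbola/((1/3)𝔖x log x) drifting to 1 at rate O(1/log
x); for (n, n+2, n+6) the fully windowed cell against (1/27)log³x·(2M − S) (inductive form) vs its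
HL value; a clean factor off (2, 𝔖, 1/9 vs 2/9) kills the bookkeeping, not the line.

NUMBERS. 𝔖({0,2}) = 2C₂ = 1.3203236…, C₂ = 0.6601618… (Debouzy's 𝔖₂ = C₂); Bombieri k = 2:
Σ_{m≤x}Λ₂(m)Λ(m+2) ∼ 4C₂x log x, ΣΛ₂(m)Λ₂(m+2) ∼ 8C₂x log²x; W_{[β,γ]} has model mean (γ−β)log m,
central window (1/3); alternating coefficients c_t = s (t even), 2 − s (t odd), s = S/M ∈ [0,2], in
general Σ_{A⊆[t]}(−1)^{|A|}2^{t−|A|}s_A; error normalisation ε N (log N)^t matches GHL's ε N^d at d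
= 1 times the weight size. Known: Evans2022 Thm 1.1 (H ≥ log^{19+ε}X, P = log^{17+ε}X), Thm 1.4 (H ≥
X^{1/6+ε}); GoldstonEtAl2008 (E₂ gaps ≤ 6); DFI 1997 saving (MN)^{−1/48}; MRT averaged HL H ≥
X^{8/33}. Items after rev 16: 4 (2 cruxes CentralCellsDimOne r2 / AlternatingSeesawLawR r3, 1
assembly, 1 provable-now support FibrationLift; BC6: declared 4 / in-cone 4 / aside 0 —
h21_check_closes cone.in_cone = all four, binder_used = {CentralCellsDimOne, AlternatingSeesawLawR,
FibrationLift}, unused = []); dropped at rev 12: CentralPrimeDeterminant (9539) / CentralHyperbola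
(9540) (parked twin statements, TWO-LAYER PLAN); dropped at rev 10: DimOne (0819, shared target —
the hides-summit carrier), FibrationLemma (0822, proved, shared), SeesawInduction (11411, absorbed
into `closes`). Route imports (rev 16): NONE beyond the gate header — the rev-13 import
Theorems.LeeYangFibresFibrationLemmaFinal is dropped (its role is the support FibrationLift), so the
FILE-level cone is the Statement's own (Summits.Parity.Statement → Literature
LinearEquationsInPrimes / ParityBatemanHorn / SingularSeries / BatemanHorn, shared by every route of
the sub) and the five unproved named facts GreenTao2010_gowersUniformity (…Transference),
GreenTao2010_gowersUniformityAt / wTrickedAt / wTrickedProductAt / mainNormalFormAt (…NormalForm),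
which rode in on that import's chain …FibreSums → Literature …WTrick → …MainReduction →
…NormalFormExtension → …NormalForm → …Transference and were used by nothing here, have LEFT the cone
(rbadge g4, 2026-08-17). Deciding theorem certified in the planner's Sketch.lean = the simulated
rev-16 file with the gate's audit commands (lean check rc 0, sorries 0, axioms
propext/Classical.choice/Quot.sound; #h21_check_closes ok, codes [], codes_advisory [], hypotheses =
the two cruxes + FibrationLift; #h21_ground flags [] on all four items; #h21_route_deps n = 22,
cite-only = the Statement decls only). Self-check probes (maxHeartbeats 400000, `first | exact? |
simpa | aesop`): CentralCellsDimOne → S, AlternatingSeesawLawR → S, S → CentralCellsDimOne, S →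
AlternatingSeesawLawR all FAIL (4/4); FibrationLift → S fails (its antecedent is the open d = 1
statement), S → FibrationLift trivial (a support, not a crux). needs-fact: NONE — no item and no
line of `closes` uses an unproved Literature fact; the constant cone is 0 unproved and, from rev 16,
so is the file cone beyond the Statement's. The route-level stamp skeleton.hides-summit
(stub_twoFlatFactors of stmt-Parity-0819, stub-summit flag of 2026-08-17T11:56:10Z whose routes[]
snapshot lists this route) is STALE since rev 10: 0819 is not an item of this route, no item, stub
or seam here is tied to the summit by a landed theorem, and the flag's routes[] is not refreshed by
drops, edits or `route relint`; clearing it is operator-side (`ledger stub-summit probe` is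
operator-only). DEFINITION REQUESTS. Later clean-up (not blocking; statements are inlined now):
notion `centralWindowWeight m = Σ_{ab=m, m^{1/3}≤a≤m^{2/3}} Λ(a)Λ(b)` and `determinantCell Ψ K N`
(topic Summits/Parity/GeneralizedHardyLittlewood/Theorems); Literature fact requests (all
conjecture-free theorems or explicitly conditional theorems, to be vendored WITHOUT importing
ParityBarrier/ParityWave0): Debouzy2019 Thm 1.1/Thm 2 (with the constant checked),
FriedlanderIwaniecPisa1978 Theorem 1 in vector form (k₁,…,k_r), DukeFriedlanderIwaniec1997 Thm 2,
Evans2022 Thm 1.1.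

Novelty: Searches (2026-08-15): `ledger negatives --problem Parity` (0); all route files of the sub (incl.
the 13:50 audit closures) + cards geh-rigidity-twin-table, determinant-moebius-core,
determinant-seesaw-eh-free read; `lit search --source zbmath|s2|crossref` ×9 ("twin almost primes
products of two primes differing by 2 asymptotic", "Bombieri asymptotic sieve Selberg formula
shifted primes", "correlations almost primes E2 Hardy-Littlewood", "generalized Selberg formula
sieve parity twin", "au:Debouzy", "determinant equation prime entries", "P2 numbers twin asymptotic
Selberg Lambda2", "almost prime pairs differing by 2 Elliott-Halberstam", "localisation Bombieri
asymptotic sieve": hits doi:10.4064/aa-28-2-177-193, arXiv:2102.12297 = Evans2022, arXiv:1907.06393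
= Debouzy2019, doi:10.2307/121035); `lit vsearch` ×3; `lit read` arXiv:2102.12297 pp.1–4,
arXiv:1907.06393 pp.1–5, 18–20; `lit frontier Parity --since 2020` (30 rows, nothing on Λ₂⊗Λ₂ /
determinant cells); `lit galaxy search --star all` ×4 (1 irrelevant hit; panama saturated twice);
openalex/arxiv/s2 partly HTTP 429, local searchd down (recorded).
Nearest prior art found: Debouzy2019 (arXiv:1907.06393) Thm 2 — ONE-sided localised seesaw at h = 2
under EH (= CentralHyperbola/HyperbolaRung, known as a reduction); BombieriRIMS1977 p.7 /
FriedlanderIwaniecPisa1978 Thm 1 (the seesaw, vector form); Evans2022 (the cell object averaged over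
shifts); card geh-rigidity-twin-table (two-sided bookkeeping as an affine table at h fixed)  [refs: 10.4064/aa-28-2-177-193, 10.2307/121035, 2102.12297, 1907.06393, doi:10.4064/aa-28-2-177-193, doi:10.2307/121035, Evans2022, Debouzy2019, BombieriRIMS1977, FriedlanderIwaniecPisa1978]

Barriers (technique_class: asymptotic-sieve elliott-halberstam bilinear-forms): - technique_class: asymptotic-sieve elliott-halberstam bilinear-forms
- Literature.Barriers.Parity.SelbergParityBarrier: the engine, not evaded — level-1 data enter only
through Bombieri's k ≥ 2 identities, which the barrier certifies as the exact extent of Type-I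
knowledge (one parameter s per system); Selberg's ghosts s = 0, 2 make even-t cells vanish resp.
odd-t cells double, so both main cruxes are genuinely parity-sensitive inputs, not sieve deductions.
- Literature.Barriers.Parity.FordFixedLevelBarrier: the law needs level x^{1−ε} for every ε
(EH-type); a fixed level gives only two-sided bounds (Ford2004), which is why the EH-free rung is
deferred to layer 2.
- Literature.Barriers.Parity.PrimePairParity: consistent — no weight-insertion-invariant deduction
reaches the cells; the extra axiom is an asymptotic for an all-prime multilinear equation, of the
bilinear kind Polymath8b §8 isolates as the only exit.
- Literature.Barriers.Parity.FordMaynardMinimalTypeII: APPLIES to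
CentralCellsDimOne/CentralPrimeDeterminant — detecting the balanced primes through identities needs
Type II across wide ranges; not evaded; the bet is that with every variable in [m^{1/3},m^{2/3}]
each identity corner is a dispersion problem with factorable moduli and a free cofactor, and the
honest residue (Type II for E₂−h) is the named layer-2 child where the line can die.
- Literature.Barriers.Parity.FordMaynardLowLevel: same concession; all level inputs behind the law
are 1−ε, priced into Alternati

History (route lifecycle, newest last):
- 2026-08-15T17:26:50Z · rev 4: restated TwoSidedLocalisationR (stmt-Parity-10877) — staffability (cone guardrail), 2/2: TwoSidedLocalisationR's antecedent EH is now spelled (∀ θ < 1, Literature.NumberTheory.Sieve.PrimesHaveLevel θ) — Iff.rfl wi (planner-rrefute-Parity-PrimeDeterminantCells-s-756100fa-g4-0)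
- 2026-08-15T17:38:21Z · rev 6: restated AlternatingSeesawLaw (stmt-Parity-9538), SeesawAlgebra (stmt-Parity-9545), Assembly (stmt-Parity-9546) — cone-repair (rrepair g2) + refuter review P1. (a) import BombieriAsymptoticSieveShiftedPrimes dropped — it rode in 18 ParityWave0 conjectures + bfi_wellFactorab (planner-rrepair-Parity-PrimeDeterminantCells-967dd235-g2-0)
- 2026-08-15T17:38:21Z · rev 6: dropped WindowedConvLevelOne, WindowedSelbergRung, TwoSidedLocalisationR, HyperbolaRung — cone-repair (rrepair g2) + refuter review P1. (a) import BombieriAsymptoticSieveShiftedPrimes dropped — it rode in 18 ParityWave0 conjectures + bfi_wellFactorab (planner-rrepair-Parity-PrimeDeterminantCells-967dd235-g2-0)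
- 2026-08-17T11:56:10Z · skeleton.hides-summit: stub_twoFlatFactors (stmt-Parity-0819) ⟷ summit (accepted theorem in Summits/Parity/GeneralizedHardyLittlewood/Theorems/DicksonFibrationDimOneEquivalence.lean) (prover-line-stmt-Parity-0819-c2-0)
- 2026-08-17T12:28:42Z · rev 10: restated Assembly (stmt-Parity-11412) — rev 10 route-repair (rbadge, needs_repair skeleton.hides-summit on the shared target stmt-Parity-0819 DimOne): re-route AROUND DimOne. Deciding theorem re-cut t (planner-rbadge-Parity-PrimeDeterminantCells-967dd235-0)
- 2026-08-17T12:28:42Z · rev 10: dropped DimOne, FibrationLemma, SeesawInduction — rev 10 route-repair (rbadge, needs_repair skeleton.hides-summit on the shared target stmt-Parity-0819 DimOne): re-route AROUND DimOne. Deciding theorem re-cut t (planner-rbadge-Parity-PrimeDeterminantCells-967dd235-0)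
- 2026-08-17T13:24:14Z · rev 12: dropped CentralPrimeDeterminant, CentralHyperbola — rev 12 (rbadge g2): DROP the two twin-instance statements CentralPrimeDeterminant (9539) / CentralHyperbola (9540) from the active item set — they are not load- (planner-rbadge-Parity-PrimeDeterminantCells-967dd235-g2-0)
- 2026-08-25T11:00:30Z · DORMANT — reconciler: no traction for 7.6 d (last activity item-evidence-added at 2026-08-17T19:12:59Z); parked, not closed — `ledger route dormant route-Parity-PrimeDete (operator:999:2423504)

sub-problem: GeneralizedHardyLittlewood · status: dormant · opened planner-plancard-Parity-GeneralizedHardyLittl-5dd377e0-0 2026-08-15T14:00:21Z · rev 18 · ledger route-Parity-PrimeDeterminantCells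
GENERATED by the gate from the ledger (D-0016/17). Provers cite these decls: `theorem foo : Summit.Parity.GeneralizedHardyLittlewood.Theses.PrimeDeterminantCells.<Decl> := …` in Summits/Parity/GeneralizedHardyLittlewood/Theorems/<Name>.lean.
-/

namespace Summit.Parity.GeneralizedHardyLittlewood.Theses.PrimeDeterminantCells

open scoped BigOperators Topology Manifold Classical MeasureTheory ProbabilityTheory Matrix InnerProductSpace ComplexConjugate ContinuousMap
open Filter Set Function TopologicalSpace MeasureTheory

attribute [summit_statement] _root_.GeneralizedHardyLittlewood

/-- item stmt-Parity-9537 · crux · rank 2 · open · by planner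
why it might fail: Law → (C ↔ S) LANDED p171052 (Theorems.PrimeDeterminantCellsCentralCellsModLaw.centralCellsDimOne_iff_ghl_of_law): mod crux 3 this IS the summit; strategist censuses s2 + r1 (2026-08-17): no-strategy-short-of-summit, birth S4 mixed swap ≡ C mod provable S1–S3; Siegel zeros mod q double the 2q cell.
sources: GreenTao2010, Harman2007, BombieriFriedlanderIwaniecActa1986, DukeFriedlanderIwaniec1997, MatomakiRadziwillTao2019, Evans2022
[crux] uniform central determinant cells: for all t ≥ 1, L, ε > 0 there is N₀ such that for N ≥ N₀,
every non-degenerate d = 1 system Ψ of t forms with ‖Ψ‖_N ≤ L and every convex K ⊆ [−N,N]: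
|Σ_{n∈K∩ℤ} Π_i W(ψ_i(n)) − (1/3)^t (log N)^t β_∞Πβ_p| ≤ ε N (log N)^t, W(m) = Σ_{ab=m,
m^{1/3}≤a≤m^{2/3}} Λ(a)Λ(b) (m ≤ 0 ↦ 0 via toNat). The parity-sensitive input of the card,
generalised from twins (t = 2, Ψ = (n, n+2): crux CentralPrimeDeterminant) to every one-dimensional
system. [difficulty: open-problem] -/
@[route_item "route-Parity-PrimeDeterminantCells", crux]
def CentralCellsDimOne : Prop :=
  ∀ (t L : ℕ), 1 ≤ t → ∀ ε : ℝ, 0 < ε → ∃ N₀ : ℕ, ∀ N : ℕ, N₀ ≤ N → ∀ Ψ : Fin t → Literature.NumberTheory.Sieve.AffLinForm 1, Literature.NumberTheory.Sieve.IsNondegenerateSystem Ψ → Literature.NumberTheory.Sieve.affLinSize Ψ N ≤ L → ∀ K : Set (Fin 1 → ℝ), Convex ℝ K → K ⊆ Literature.NumberTheory.Sieve.realBox 1 N → |(∑ n ∈ (Literature.NumberTheory.Sieve.latticeBox 1 N).filter (fun n => Literature.NumberTheory.Sieve.realPoint n ∈ K), ∏ i, ∑ ab ∈ (Nat.divisorsAntidiagonal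 ((Ψ i).eval n).toNat).filter (fun ab : ℕ × ℕ => ((((Ψ i).eval n).toNat : ℕ) : ℝ) ^ (1 / 3 : ℝ) ≤ (ab.1 : ℝ) ∧ (ab.1 : ℝ) ≤ ((((Ψ i).eval n).toNat : ℕ) : ℝ) ^ (2 / 3 : ℝ)), ArithmeticFunction.vonMangoldt ab.1 * ArithmeticFunction.vonMangoldt ab.2) - (1 / 3 : ℝ) ^ t * Real.log N ^ t * (Literature.NumberTheory.Sieve.archFactor Ψ K * Literature.NumberTheory.Sieve.singularProduct Ψ)| ≤ ε * (N : ℝ) * Real.log N ^ t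

/-- item stmt-Parity-11410 · crux · rank 3 · open · by planner
why it might fail: Conditional only: every Bombieri/FI flip (stub_seesawStep) needs level x^{1−ε} for mixed Λ/W tuple sequences (EH + tuple-GEH, beyond LargeSieveLevelHalf; a fixed level gives only Ford's two-sided bounds); DimOne → (Law ↔ C) kernel-checked (law_iff_cells): given S it is crux 2; t = 1 base PNT-level.
sources: BombieriRIMS1977, FriedlanderIwaniecPisa1978, Debouzy2019, arXiv:1907.06393, Ford2004, Polymath8b2014
[crux] inductive alternating seesaw law (rev 3 restatement of AlternatingSeesawLaw stmt-Parity-9538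
after refuter review rreview-0815T14 P1: for t ≥ 3 the per-coordinate Bombieri flips give the
inclusion–exclusion main term Σ_{A⊆[t]} (−1)^{|A|} 2^{t−|A|} (M/M_A) S_A over sub-tuples A, which
equals the two-term form M + (−1)^t (S − M) exactly when every proper sub-tuple has its
Hardy–Littlewood value): for all t ≥ 1 and L, IF DimOne holds for every t' < t (all L'), THEN for
all ε > 0 there is N₀ such that for N ≥ N₀, uniformly over non-degenerate d = 1 systems Ψ of t forms
with ‖Ψ‖_N ≤ L and convex K ⊆ [−N,N]: |Σ_{n∈K∩ℤ} Π_i W(ψ_i(n)) − (1/3)^t (log N)^t (M + (−1)^t (S −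
M))| ≤ ε N (log N)^t, W(m) = Σ_{ab=m, m^{1/3}≤a≤m^{2/3}} Λ(a)Λ(b), S = vonMangoldtSum Ψ K N, M =
archFactor Ψ K · singularProduct Ψ. t = 1 (hypothesis vacuous) is PNT-level: Σ_{n∈K} W(an+b) =
(1/3)(log N)(2M − S) + o; t = 2 needs only PNT below it and reads Σ W(ψ₁n)W(ψ₂n) = (1/9)(log N)² S +
o (two flips s ↦ 2 − s ↦ s; known under EH + GEH₂-type hypotheses at Ψ = (n, n+2)); t = 3: 8 − 4Σs_i
+ 2Σs_{ij} − s_{123} = 2 − s_{123} under HL for pairs. Weaker than the rev-2 law and exactly what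
the mechanism supports; known -/
@[route_item "route-Parity-PrimeDeterminantCells", crux]
def AlternatingSeesawLawR : Prop :=
  ∀ (t L : ℕ), 1 ≤ t → (∀ (t' L' : ℕ), 1 ≤ t' → t' < t → ∀ ε : ℝ, 0 < ε → ∃ N₀ : ℕ, ∀ N : ℕ, N₀ ≤ N → ∀ Ψ : Fin t' → Literature.NumberTheory.Sieve.AffLinForm 1, Literature.NumberTheory.Sieve.IsNondegenerateSystem Ψ → Literature.NumberTheory.Sieve.affLinSize Ψ N ≤ L' → ∀ K : Set (Fin 1 → ℝ), Convex ℝ K → K ⊆ Literature.NumberTheory.Sieve.realBox 1 N → |Literature.NumberTheory.Sieve.vonMangoldtSum Ψ K N - Literature.NumberTheory.Sieve.archFactor Ψ K * Literature.NumberTheory.Sieve.singularProduct Ψ| ≤ ε * (N : ℝ)) → ∀ ε : ℝ, 0 < ε → ∃ N₀ : ℕ, ∀ N : ℕ, N₀ ≤ N → ∀ Ψ : Fin t → Literature.NumberTheory.Sieve.AffLinForm 1, Literature.NumberTheory.Sieve.IsNondegenerateSystem Ψ → Literature.NumberTheory.Sieve.affLinSize Ψ N ≤ L → ∀ K : Set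 (Fin 1 → ℝ), Convex ℝ K → K ⊆ Literature.NumberTheory.Sieve.realBox 1 N → |(∑ n ∈ (Literature.NumberTheory.Sieve.latticeBox 1 N).filter (fun n => Literature.NumberTheory.Sieve.realPoint n ∈ K), ∏ i, ∑ ab ∈ (Nat.divisorsAntidiagonal ((Ψ i).eval n).toNat).filter (fun ab : ℕ × ℕ => ((((Ψ i).eval n).toNat : ℕ) : ℝ) ^ (1 / 3 : ℝ) ≤ (ab.1 : ℝ) ∧ (ab.1 : ℝ) ≤ ((((Ψ i).eval n).toNat : ℕ) : ℝ) ^ (2 / 3 : ℝ)), ArithmeticFunction.vonMangoldt ab.1 * ArithmeticFunction.vonMangoldt ab.2) - (1 / 3 : ℝ) ^ t * Real.log N ^ t * (Literature.NumberTheory.Sieve.archFactor Ψ K * Literature.NumberTheory.Sieve.singularProduct Ψ + (-1 : ℝ) ^ t * (Literature.NumberTheory.Sieve.vonMangoldtSum Ψ K N - Literature.NumberTheory.Sieve.archFactor Ψ K * Literature.NumberTheory.Sieve.singularProduct Ψ))| ≤ ε * (N : ℝ) * Real.log N ^ t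

/-- item stmt-Parity-18286 · support · rank 9 · open · by planner
sources: GreenTao2010
[support] fibration lift (Green–Tao 2010, remark after Conj. 1.2): the one-dimensional statement —
Conj. 1.2 at d = 1, uniform in L (for all t ≥ 1, L, ε > 0 there is N₀ with |vonMangoldtSum Ψ K N −
archFactor Ψ K · singularProduct Ψ| ≤ εN for N ≥ N₀, every non-degenerate Ψ : Fin t → AffLinForm 1
with ‖Ψ‖_N ≤ L and every convex K ⊆ [−N,N]; inlined verbatim, no DimOne decl) — implies
GeneralizedHardyLittlewood. PROVED in the tree:
Theorems.FibrationGlue.generalizedHardyLittlewood_of_dimOne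
(Summits/Parity/GeneralizedHardyLittlewood/Theorems/LeeYangFibresFibrationLemmaFinal.lean, standard
axioms) has exactly this antecedent, so `theorem fibrationLift_proof : FibrationLift := fun h =>
FibrationGlue.generalizedHardyLittlewood_of_dimOne h` closes it in one line from a Theorems file
importing that module. It is a hypothesis of `closes` (as FibrationLemma stmt-Parity-0822 is in
route LeeYangFibres) precisely so that the ROUTE FILE imports no Theorems module and its file-level
cone is the Statement's own (rev 16, rbadge g4). [difficulty: provable-now] -/
@[route_item "route-Parity-PrimeDeterminantCells", crux]
def FibrationLift : Prop :=
  (∀ (t L : ℕ), 1 ≤ t → ∀ ε : ℝ, 0 < ε → ∃ N₀ : ℕ, ∀ N : ℕ, N₀ ≤ N → ∀ Ψ : Fin t → Literature.NumberTheory.Sieve.AffLinForm 1, Literature.NumberTheory.Sieve.IsNondegenerateSystem Ψ → Literature.NumberTheory.Sieve.affLinSize Ψ N ≤ L → ∀ K : Set (Fin 1 → ℝ), Convex ℝ K → K ⊆ Literature.NumberTheory.Sieve.realBox 1 N → |Literature.NumberTheory.Sieve.vonMangoldtSum Ψ K N - Literature.NumberTheory.Sieve.archFactor Ψ K * Literature.NumberTheory.Sieve.singularProduct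 Ψ| ≤ ε * (N : ℝ)) → GeneralizedHardyLittlewood

-- earlier Assembly (stmt-Parity-11412, replaced 2026-08-17T12:28:42Z -> stmt-Parity-18177): retired by None — AlternatingSeesawLawR → CentralCellsDimOne → SeesawInduction → FibrationLemma → GeneralizedHardyLittlewood
-- earlier Assembly (stmt-Parity-9546, replaced 2026-08-15T17:38:21Z -> stmt-Parity-11412): retired by None — AlternatingSeesawLaw → CentralCellsDimOne → SeesawAlgebra → FibrationLemma → GeneralizedHardyLittlewood
/-- item stmt-Parity-18177 · assembly · rank 1 · open · by planner
sources: BombieriRIMS1977, GreenTao2010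
[assembly] rev 10: CentralCellsDimOne → AlternatingSeesawLawR → GeneralizedHardyLittlewood — the two
ranked cruxes give the conjunct: strong induction on t (the law's antecedent at t is the induction
hypothesis; subtract the two cell estimates at ε' = ε/(2·3^t) and cancel (log N)^t > 0 for N ≥ 2)
yields Green–Tao Conj. 1.2 at d = 1 uniformly in the shifts, then the tree's proved Theses-free
fibration lemma Theorems.FibrationGlue.generalizedHardyLittlewood_of_dimOne lifts to all d. PROVED
inline by the deciding theorem `closes` (which builds this statement and applies it), hence closable
by a prover in one line; replaces the rev-6 cut through SeesawInduction/FibrationLemma/DimOne.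
[difficulty: provable-now] [BombieriRIMS1977, GreenTao2010] -/
@[route_item "route-Parity-PrimeDeterminantCells"]
def Assembly : Prop :=
  CentralCellsDimOne → AlternatingSeesawLawR → GeneralizedHardyLittlewood

-- records of items no longer active in this route (dropped / restated):
-- earlier FibrationLemma (stmt-Parity-0822, dropped 2026-08-17T12:28:42Z): proved by Summit.Parity.GeneralizedHardyLittlewood.Theorems.leeYangFibres_fibrationLemma — DimOne → GeneralizedHardyLittlewood
-- earlier TwoSidedLocalisationR (stmt-Parity-10877, replaced 2026-08-15T17:26:50Z -> stmt-Parity-11366): retired by None — Literature.NumberTheory.Sieve.LevelOfDistribution.ElliottHalberstam → WindowedConvLevelOne → ∀ β γ β' γ' : ℝ, 0 < β → β < γ → γ < 1 → 0 < β' → β' < γ' → γ' < 1 → (fun x : ℝ => (∑ n ∈ Finset.Icc 1 ⌊x⌋₊, (∑ ab ∈ (Nat.divisorsAntidiagonal n).filter (fun ab : ℕ × ℕ => (n : ℝ) ^ β ≤ 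
-- earlier AlternatingSeesawLaw (stmt-Parity-9538, replaced 2026-08-15T17:38:21Z -> stmt-Parity-11410): retired by None — ∀ (t L : ℕ), 1 ≤ t → ∀ ε : ℝ, 0 < ε → ∃ N₀ : ℕ, ∀ N : ℕ, N₀ ≤ N → ∀ Ψ : Fin t → Literature.NumberTheory.Sieve.AffLinForm 1, Literature.NumberTheory.Sieve.IsNondegenerateSystem Ψ → Literature.NumberTheory.Sieve.affLinSize Ψ N ≤ L → ∀ K : Set (Fin 1 → ℝ), Convex ℝ K → K ⊆ Literature
-- earlier ConvMomentLevelOne (stmt-Parity-9541, dropped 2026-08-15T17:13:46Z): refuted by Summit.Parity.GeneralizedHardyLittlewood.Theorems.PrimeDeterminantCellsConvMomentLevelOne_refuted @ f8ef27fbfd2d — ∀ i j : ℕ, ∀ A : Literature.NumberTheory.Sieve.SieveSequence, (∀ m : ℕ, A.a m = if m % 2 = 1 then ∑ cd ∈ Nat.divisorsAntidiagonal (m + 2), ArithmeticFunction.vonMangoldt cd.1 * Real.log cd.1 ^ i * 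
-- earlier HyperbolaRung (stmt-Parity-9544, replaced 2026-08-15T17:21:57Z -> stmt-Parity-11350): retired by None — Literature.NumberTheory.Sieve.LevelOfDistribution.ElliottHalberstam → CentralHyperbola → Asymptotics.IsEquivalent Filter.atTop (fun N : ℕ => ∑ n ∈ Finset.Icc 1 N, ArithmeticFunction.vonMangoldt n * ArithmeticFunction.vonMangoldt (n + 2)) (fun N : ℕ => Literature.NumberTheory.Sieve.singul
-- earlier SeesawAlgebra (stmt-Parity-9545, replaced 2026-08-15T17:38:21Z -> stmt-Parity-11411): retired by None — AlternatingSeesawLaw → CentralCellsDimOne → DimOne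

/-! D-0027 §2.1 — DECIDING THEOREM (planner-authored via `route open/edit --closes-file`; by planner-rbadge-Parity-PrimeDeterminantCells-967dd235-g4-0 2026-08-17T14:47:35Z):
its hypotheses are this route's items and its conclusion the sub-problem Statement (glue_lint), and it elaborates with this file. -/

/-- D-0027 §2.1 deciding theorem of route PrimeDeterminantCells (rev 16, 2026-08-17, route-repair rbadge g4:
the route FILE no longer imports any Theorems module — the d = 1 → all-d fibration seam is the provable-now
support item `FibrationLift`, a hypothesis here exactly as `FibrationLemma` is in route LeeYangFibres, so the
file's import cone is the Statement's own). Hypotheses: the two ranked cruxes — the uniform central determinant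
cells `CentralCellsDimOne` (rank 2) and the inductive alternating seesaw law `AlternatingSeesawLawR` (rank 3) —
and the support `FibrationLift` (Green–Tao 2010, remark after Conj. 1.2; PROVED in the tree as
`Theorems.FibrationGlue.generalizedHardyLittlewood_of_dimOne`, whose hypothesis is this item's antecedent
verbatim, so `theorem fibrationLift_proof : FibrationLift := fun h => …generalizedHardyLittlewood_of_dimOne h`
closes it in one line from a Theorems file). The proof BUILDS the route's `Assembly` item
(`CentralCellsDimOne → AlternatingSeesawLawR → GeneralizedHardyLittlewood`) inline and applies it: strong
induction on the number of forms `t` (the law's antecedent at `t` is literally the induction hypothesis; the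
two cell estimates at `ε' = ε/(2·3^t)` differ by `(1/3)^t (log N)^t · |S − M|`, and `(log N)^t > 0` for
`N ≥ 2` is cancelled) yields Green–Tao's Conjecture 1.2 at `d = 1` uniformly in the shifts, and `FibrationLift`
lifts it to every dimension, i.e. to the sub-problem Statement `GeneralizedHardyLittlewood`. -/
@[closes "route-Parity-PrimeDeterminantCells"] theorem closes (hC : CentralCellsDimOne) (hL : AlternatingSeesawLawR)
    (hF : FibrationLift) : _root_.GeneralizedHardyLittlewood := by
  have hA : Assembly := by
    intro hC hL
    refine hF ?_
    intro t
    induction t using Nat.strong_induction_on with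
    | h t ih =>
    intro L ht ε hε
    have h3pos : (0 : ℝ) < (3 : ℝ) ^ t := by positivity
    have h3ne : (3 : ℝ) ^ t ≠ 0 := ne_of_gt h3pos
    set ε' : ℝ := ε / (2 * 3 ^ t) with hε'
    have hε'pos : 0 < ε' := by positivity
    -- the law at `t`, fed with the induction hypothesis (= the d = 1 statement below `t`), and the cells at `t`
    obtain ⟨N₁, hN₁⟩ := hL t L ht (fun t' L' ht' hlt => ih t' hlt L' ht') ε' hε'pos
    obtain ⟨N₂, hN₂⟩ := hC t L ht ε' hε'pos
    refine ⟨max 2 (max N₁ N₂), fun N hN Ψ hΨ hΨL K hK hKN => ?_⟩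
    have hN2 : 2 ≤ N := le_trans (le_max_left _ _) hN
    have hNN₁ : N₁ ≤ N := le_trans (le_trans (le_max_left _ _) (le_max_right _ _)) hN
    have hNN₂ : N₂ ≤ N := le_trans (le_trans (le_max_right _ _) (le_max_right _ _)) hN
    have h1 := hN₁ N hNN₁ Ψ hΨ hΨL K hK hKN
    have h2 := hN₂ N hNN₂ Ψ hΨ hΨL K hK hKN
    set S : ℝ := Literature.NumberTheory.Sieve.vonMangoldtSum Ψ K N with hS
    set M : ℝ := Literature.NumberTheory.Sieve.archFactor Ψ K *
      Literature.NumberTheory.Sieve.singularProduct Ψ with hM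
    have h1N : (1 : ℝ) < (N : ℝ) := by exact_mod_cast (lt_of_lt_of_le (by norm_num) hN2)
    have hlogpos : 0 < Real.log (N : ℝ) := Real.log_pos h1N
    have hHpos : 0 < (1 / 3 : ℝ) ^ t * Real.log (N : ℝ) ^ t := by positivity
    -- the two cell estimates share the cell sum `C`; subtract them
    have key : ∀ (C A B e : ℝ), |C - A| ≤ e → |C - B| ≤ e → |A - B| ≤ 2 * e := by
      intro C A B e hA hB
      calc |A - B| ≤ |A - C| + |C - B| := abs_sub_le A C B
        _ = |C - A| + |C - B| := by rw [abs_sub_comm A C]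
        _ ≤ e + e := add_le_add hA hB
        _ = 2 * e := by ring
    have h3 := key _ _ _ _ h1 h2
    have h4 : |(1 / 3 : ℝ) ^ t * Real.log (N : ℝ) ^ t * (M + (-1 : ℝ) ^ t * (S - M)) -
        (1 / 3 : ℝ) ^ t * Real.log (N : ℝ) ^ t * M| = (1 / 3 : ℝ) ^ t * Real.log (N : ℝ) ^ t * |S - M| := by
      rw [show (1 / 3 : ℝ) ^ t * Real.log (N : ℝ) ^ t * (M + (-1 : ℝ) ^ t * (S - M)) -
          (1 / 3 : ℝ) ^ t * Real.log (N : ℝ) ^ t * M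
          = ((1 / 3 : ℝ) ^ t * Real.log (N : ℝ) ^ t) * ((-1 : ℝ) ^ t * (S - M)) by ring,
        abs_mul, abs_of_pos hHpos, abs_mul, abs_neg_one_pow, one_mul]
    have h5 : (1 / 3 : ℝ) ^ t * Real.log (N : ℝ) ^ t * |S - M| ≤ 2 * (ε' * (N : ℝ) * Real.log (N : ℝ) ^ t) := by
      rw [← h4]; exact h3
    have h6 : (1 / 3 : ℝ) ^ t * Real.log (N : ℝ) ^ t * |S - M| ≤
        (1 / 3 : ℝ) ^ t * Real.log (N : ℝ) ^ t * (ε * (N : ℝ)) := by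
      calc (1 / 3 : ℝ) ^ t * Real.log (N : ℝ) ^ t * |S - M|
          ≤ 2 * (ε' * (N : ℝ) * Real.log (N : ℝ) ^ t) := h5
        _ = (1 / 3 : ℝ) ^ t * Real.log (N : ℝ) ^ t * (ε * (N : ℝ)) := by
            rw [hε', one_div_pow]; field_simp
    exact le_of_mul_le_mul_left h6 hHpos
  exact hA hC hL

end Summit.Parity.GeneralizedHardyLittlewood.Theses.PrimeDeterminantCells
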